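import Mathlib
import Literature.AlgebraicGeometry.Resolution.WeightedResolutionDatum
import Summits.ResolutionOfSingularities.ResolutionOfSingularities.Theorems.WeightedInvariantHypersurfaceLocalGameEFT3

/-!
# H2a⁗ `LocalWeightedDropEFT4` — the canonical intrinsic e.f.t. game with the ∀-MODEL OPEN PRESENTATION clause (open′)
(res-L1-w43-plan-1 g7, door registrar; eft_sketch v9; CHAIN w43 v4.6 / CRUX-PLAN addendum 12–13)

[OURS · candidates · conjecture-grade; nothing here asserts anything about Hironaka's problem.]

WHY (open′).  The assembly prover res-L1-w43-stub-9 = res-D-brk-1 (TP5′, STATUS 2026-08-27T05:41:49Z; [S4] core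
`isRegularWeightedCentre_of_isCanonicalCentre_of_charts` p502377) showed that [S3] (existence of the canonical centre) and [S4]
(it is a regular weighted centre) consume the open-presentation clause in the ∀-MODEL, STRATUM-EXACT form with a positively
weighted system whose differentials are INDEPENDENT at the point: the landed (open) = `JOpenPresentation` (∃ SOME finite-type
model) cannot be moved onto `Y` by the assembly, does not give independence (a weighted monomial ideal is not determined by the
centre: (o10), p500449/p500698) and is not stratum-exact.  Registrar's ruling TP5 (CHAIN v4.6): the clause set grows exactly on
the assembly's typed demand — hence this module: (open′) = `JOpenPresentationForall` (TP5′ verbatim), `LocalWeightedDropEFT4` =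
`LocalWeightedDropEFT3` with (open) replaced by (open′), and the sorry-free seam `eft_of_eft4` (H2a⁗ ⇒ H2a′; the game clause is
unchanged, so the H2a′ rungs still bear on it).  Every intended `(ι, J)` built from orders / differential operators / maximal
contact data on an affine neighbourhood satisfies (open′) in characteristic zero by construction (ABQTW); in characteristic `p`
it is part of the conjecture.
-/

set_option linter.dupNamespace false

noncomputable section

open IsLocalRing Literature.AlgebraicGeometry.Resolution

namespace Summit.ResolutionOfSingularities.ResolutionOfSingularities.Cruxes.HypersurfaceCentreConstruction.LocalEngine

/-- (c9′-open′) ∀-MODEL STRATUM-EXACT OPEN PRESENTATION (stub-9 TP5′ verbatim).  For EVERY finite-type model `(A, 𝔪, F)` of a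
position — `A` of finite type over the perfect ground field, `𝔪` a prime with `A_𝔪` regular, `F ∈ A` non-zero and in `𝔪² A_𝔪` —
there are `h ∉ 𝔪` and ONE positively weighted system `U : Fin N → A` whose members lie in `𝔪 A_𝔪` with LINEARLY INDEPENDENT
images in the cotangent space of `A_𝔪`, such that on the basic open `D(h)`: a prime `𝔮` contains all `U i` IFF it lies on the
hypersurface and in the SAME `ι`-stratum as `𝔪` (stratum-exactness), and at every such `𝔮` the centre filtration `J (A_𝔮) F` is
presented by `U, W` (the weighted monomial ideals extended to `A_𝔮`).  Reading for the assembly: `A := Γ(Y, U₀)`, `𝔪 :=` the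
prime of a point of the maximum locus, `F :=` a local generator of the hypersurface; zero-weight r.s.p. members are dropped (A8). -/
def JOpenPresentationForall (p : ℕ) (ι : (R : Type) → [CommRing R] → R → Ordinal.{0})
    (J : (R : Type) → [CommRing R] → R → ℕ → Ideal R) : Prop :=
  ∀ (k₀ : Type) [Field k₀] [CharP k₀ p] [PerfectField k₀]
    (A : Type) [CommRing A] [Algebra k₀ A] [Algebra.FiniteType k₀ A] (𝔪 : Ideal A) [𝔪.IsPrime] (F : A),
    IsRegularLocalRing (Localization.AtPrime 𝔪) →
    algebraMap A (Localization.AtPrime 𝔪) F ≠ 0 →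
    algebraMap A (Localization.AtPrime 𝔪) F ∈ (maximalIdeal (Localization.AtPrime 𝔪)) ^ 2 →
    ∃ h : A, h ∉ 𝔪 ∧ ∃ (N : ℕ) (U : Fin N → A) (W : Fin N → ℕ), (∀ i, 0 < W i) ∧
      (∃ hU : ∀ i, algebraMap A (Localization.AtPrime 𝔪) (U i) ∈ maximalIdeal (Localization.AtPrime 𝔪),
        LinearIndependent (ResidueField (Localization.AtPrime 𝔪))
          (fun i => ((maximalIdeal (Localization.AtPrime 𝔪)).toCotangent ⟨_, hU i⟩ :
            CotangentSpace (Localization.AtPrime 𝔪)))) ∧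
      ∀ (𝔮 : Ideal A) [𝔮.IsPrime], h ∉ 𝔮 →
        ((∀ i, U i ∈ 𝔮) ↔
          (F ∈ 𝔮 ∧ ι (Localization.AtPrime 𝔮) (algebraMap A (Localization.AtPrime 𝔮) F) =
            ι (Localization.AtPrime 𝔪) (algebraMap A (Localization.AtPrime 𝔪) F))) ∧
        ((∀ i, U i ∈ 𝔮) → ∀ m : ℕ,
          J (Localization.AtPrime 𝔮) (algebraMap A (Localization.AtPrime 𝔮) F) m =
            (weightedMonomialIdeal U W m).map (algebraMap A (Localization.AtPrime 𝔮)))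

/-- H2a⁗ (eft_sketch v9): `LocalWeightedDropEFT3` with (open) replaced by the ∀-model stratum-exact (open′); all other clauses
verbatim ((c6) (c7) (c8) (c10), `JIsoInvariant`, (c11), (c9′) `CanonicalGameClause`, (c12a) unit invariance of `ι` and `J`). -/
@[conjecture] def LocalWeightedDropEFT4 (p : ℕ) : Prop :=
  ∃ (ι : (R : Type) → [CommRing R] → R → Ordinal.{0}) (J : (R : Type) → [CommRing R] → R → ℕ → Ideal R),
  IotaIsoInvariant ι ∧ IotaGenerizationMonotone ι ∧ IotaUpperSemicontinuous ι ∧ IotaTorusFactorMonotone ι ∧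
  JIsoInvariant J ∧ IotaJEssSmoothCompatible ι J ∧ CanonicalGameClause p ι J ∧ JOpenPresentationForall p ι J ∧
  IotaUnitInvariant ι ∧ JUnitInvariant J

/-- Seam (sorry-free): H2a⁗ ⇒ H2a′ (same proof as `eft_of_eft3`: only the game clause is used). -/
theorem eft_of_eft4 (p : ℕ) : LocalWeightedDropEFT4 p → LocalWeightedDropEFT p := by
  rintro ⟨ι, J, hiso, -, -, -, -, -, hgame, -, -, -⟩
  refine ⟨ι, hiso, ?_⟩
  intro k₀ _ _ _ S _ _ _ _ f hf0 hf2
  obtain ⟨P, hP, -, -, -, -, n, u, w, hspan, hrk, hpos, hctr, -, hadm, hsucc⟩ :=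
    hgame k₀ S f hf0 hf2
  refine ⟨n, u, w, hspan, hrk, hpos, ?_, ?_⟩
  · intro P' _ hP'
    haveI := hP
    have hle : P ≤ P' := by
      rw [← hctr]
      apply Ideal.span_le.mpr
      rintro x ⟨i, hi, rfl⟩
      exact hP' i hi
    exact hadm P' hle
  · intro 𝔫 _ ht hm hv a g hfg hndvd hsing
    haveI := hP
    have hPm : P ≤ maximalIdeal S := IsLocalRing.le_maximalIdeal hP.ne_top
    exact hsucc 𝔫 ht ((Ideal.map_mono hPm).trans hm) hv a g hfg hndvd hsing

end Summit.ResolutionOfSingularities.ResolutionOfSingularities.Cruxes.HypersurfaceCentreConstruction.LocalEngine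

end
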